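import Literature.Analysis.FluidPDE.LocalPressureLiouvilleKernel
import Literature.Analysis.FluidPDE.NormalisedPressurePowerWeightBoundProofs
import Literature.Analysis.FluidPDE.NewtonPotentialCZTest
import Literature.Analysis.FluidPDE.CKNPressureCZ
import HarnessLib

/-!
# Tools for the slab pressure oscillation estimate: the Calderón–Zygmund bound for the
regularised near field of an `L³` velocity, and the mollifiers `λ_δ = ΔΦ_δ`

Analysis/FluidPDE support file (theorems only, everything PROVED) on the discharge path of the
named fact `Literature.Analysis.FluidPDE.kangMiuraTsai_local_pressure_bound`
(`LocalLerayPressureBound.lean`; Kang–Miura–Tsai, IMRN 2021 = arXiv:1812.10509, §8: "By the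
Calderon–Zygmund estimate, `∫_{B_{3R/2}(x₀)} |p_loc|^q ≤ c_q ∫_{B_{3R}(x₀)} |v|^{2q}`").

On a.e. time slice the Liouville step (`LocalPressureLiouville.lean`) identifies the
`λ_δ`-mollified pressure gradient with the gradient of the explicit regularised potential
`c ↦ ∫ D²Φ_δ(c - y)(v, v) dy` (renormalised at infinity). Its **near field**, the part of the
integral over `y ∈ S = B_{2k}(x₀)`, is the regularised Hessian convolution of the density
`(1_S v) ⊗ (1_S v)`; this file bounds it in `L^{3/2}` uniformly in `δ`:

* `exists_eLpNorm_hessConv_le_of_memLp` — **the Calderón–Zygmund bound for the regularised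
  Hessian kernels on compactly supported `L^p` densities** (extension of the tree's
  `exists_eLpNorm_hessConv_le_of_bdd`, stated for bounded densities, by truncation, dominated
  convergence and Fatou);
* `exists_eLpNorm_nearField_le` — **the quadratic near field**
  `N_δ[w](c) = ∫ D²Φ_δ(c - y)(w y, w y) dy` of a compactly supported field with `|w|² ∈ L^{3/2}`
  satisfies `‖N_δ[w]‖_{3/2} ≤ C ‖|w|²‖_{3/2}` uniformly in `δ > 0` (polarisation over the
  standard frame, `clm_apply_apply_eq_sum_basisFun`, `fderiv_fderiv_apply_polarisation`);
* the mollifiers: `|λ_δ| ≤ M δ⁻³`, `∫ λ_δ = 1`, `∫ |λ_δ| = ∫ |λ₁|`, and **Lebesgue points**: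
  `(λ_δ ⋆ p)(c) → p(c)` as `δ = 1/(n+1) → 0` for a.e. `c`, for every locally integrable `p`
  (`IsUnifLocDoublingMeasure.ae_tendsto_average_norm_sub`), together with the `L¹` bound
  `∫_{B_r(x₀)} |λ_δ ⋆ p| ≤ (∫|λ₁|) ∫_{B_{r+1}(x₀)} |p|` for `δ ≤ 1`.

## Mathlib / tree search

Tree: `exists_eLpNorm_hessConv_le_of_bdd` (`NormalisedPressurePowerWeightBoundProofs`),
`fderiv_fderiv_apply_polarisation` (`NewtonPotentialCZTest`), `clm_apply_apply_eq_sum_basisFun`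
(`CKNPressureCZ`), `newtonReg`, `laplacian_newtonReg`, `exists_bound_fderiv_fderiv_newtonReg`,
`integral_abs_laplacian_newtonReg` (`NormalisedPressureL2Bound`), `newtonFarLaplacian_scale`,
`integral_newtonFarLaplacian` (`NewtonPotential`), `exists_bound_newtonFarLaplacian` (`WeylLemmaBall`),
`convolution_lsmul_apply`. Mathlib: `Lp.eLpNorm_lim_le_liminf_eLpNorm`,
`tendsto_integral_of_dominated_convergence`, `IsUnifLocDoublingMeasure.ae_tendsto_average_norm_sub`,
`Measure.addHaar_closedBall`, `eLpNorm_sum_le`, `lintegral_lintegral_swap`.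

## References

* K. Kang, H. Miura, T.-P. Tsai, IMRN 2021 = arXiv:1812.10509, §8 (proof of Lemma 3.4).
  [`KangMiuraTsai2020`]
* E. M. Stein, *Singular integrals and differentiability properties of functions* (1970),
  Ch. II §4.2 Thm. 3. [`Stein1971`]
-/

noncomputable section

open MeasureTheory Set Filter Topology Function Metric
open scoped ENNReal NNReal RealInnerProductSpace Laplacian Convolution

namespace Literature.Analysis.FluidPDE

-- nested operator types `ℝ³ →L[ℝ] ℝ³ →L[ℝ] ℝ³ →L[ℝ] ℝ`
set_option maxSynthPendingDepth 3

/-! ## Calderón–Zygmund for the regularised Hessian kernels on `L^p` densities -/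

section CZ

/-- The regularised Hessian kernel `k^a_ε = ∂ₐ∂ₐΦ_ε` (`ε > 0`) is continuous and bounded.
[folklore] -/
theorem continuous_and_bounded_hessKernel {ε : ℝ} (hε : 0 < ε) (a : EuclideanSpace ℝ (Fin 3)) :
    Continuous (fun z : EuclideanSpace ℝ (Fin 3) => fderiv ℝ (fun s => fderiv ℝ (newtonReg ε) s a) z a) ∧
      ∃ M : ℝ, ∀ z, |fderiv ℝ (fun s => fderiv ℝ (newtonReg ε) s a) z a| ≤ M := by
  have hc : Continuous fun z : EuclideanSpace ℝ (Fin 3) => fderiv ℝ (fun s => fderiv ℝ (newtonReg ε) s a) z a :=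
    FluidPDE.continuous_fderiv_fderiv_apply (contDiff_newtonReg ε (n := 2)) a a
  refine ⟨hc, ?_⟩
  obtain ⟨M₀, M₁, M₂, hM₀, -, -⟩ := exists_bounds_fderiv2_newtonReg hε
  refine ⟨M₀ * ‖a‖ * ‖a‖, fun z => ?_⟩
  rw [← fderiv2_newtonReg_apply_self, ← Real.norm_eq_abs]
  calc ‖fderiv ℝ (fderiv ℝ (newtonReg ε)) z a a‖ ≤ ‖fderiv ℝ (fderiv ℝ (newtonReg ε)) z a‖ * ‖a‖ :=
        ContinuousLinearMap.le_opNorm _ _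
    _ ≤ ‖fderiv ℝ (fderiv ℝ (newtonReg ε)) z‖ * ‖a‖ * ‖a‖ := by
        gcongr; exact ContinuousLinearMap.le_opNorm _ _
    _ ≤ M₀ * ‖a‖ * ‖a‖ := by gcongr; exact hM₀ z

/-- **Calderón–Zygmund bound for the regularised Hessian kernels on compactly supported `L^p`
densities, uniform in the scale** (Stein 1970, Ch. II §4.2 Thm. 3): for `1 < p < ∞` there is `C`
with `‖∫ f(t) ∂ₐ∂ₐΦ_ε(· - t) dt‖_p ≤ C ‖f‖_p` for every `ε > 0`, `|a| ≤ 2` and every measurable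
compactly supported `f ∈ L^p` (the tree's `exists_eLpNorm_hessConv_le_of_bdd` on the truncations
`max(-m, min(m, f))`, dominated convergence in the pairing and Fatou in `L^p`).
[cite: Stein1971, Ch. II §4.2 Thm 3] -/
theorem exists_eLpNorm_hessConv_le_of_memLp {p : ℝ≥0∞} (hp1 : 1 < p) (hp2 : p < ⊤) :
    ∃ C : ℝ≥0, ∀ ε : ℝ, 0 < ε → ∀ a : EuclideanSpace ℝ (Fin 3), ‖a‖ ≤ 2 →
      ∀ f : EuclideanSpace ℝ (Fin 3) → ℝ, Measurable f → HasCompactSupport f → MemLp f p volume →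
        eLpNorm (fun x => ∫ t, f t * fderiv ℝ (fun s => fderiv ℝ (newtonReg ε) s a) (x - t) a)
          p volume ≤ C * eLpNorm f p volume := by
  obtain ⟨C, hC⟩ := exists_eLpNorm_hessConv_le_of_bdd hp1 hp2
  refine ⟨C, fun ε hε a ha f hf hfc hfp => ?_⟩
  obtain ⟨hkc, Mk, hMk⟩ := continuous_and_bounded_hessKernel hε a
  set k : EuclideanSpace ℝ (Fin 3) → ℝ := fun z => fderiv ℝ (fun s => fderiv ℝ (newtonReg ε) s a) z a
    with hk
  -- truncations
  set fm : ℕ → EuclideanSpace ℝ (Fin 3) → ℝ := fun m x => max (-(m : ℝ)) (min (m : ℝ) (f x)) with hfm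
  have hfm_meas : ∀ m, Measurable (fm m) := fun m => measurable_const.max (measurable_const.min hf)
  have hfm_abs : ∀ m x, |fm m x| ≤ |f x| := by
    intro m x
    simp only [hfm]
    rcases le_total (f x) (-(m : ℝ)) with h1 | h1
    · rw [min_eq_right (h1.trans (by linarith [(m.cast_nonneg : (0 : ℝ) ≤ m)])), max_eq_left h1]
      rw [abs_of_nonpos (by linarith [(m.cast_nonneg : (0 : ℝ) ≤ m)] : (-(m : ℝ)) ≤ 0)]
      have : |f x| = -f x := abs_of_nonpos (h1.trans (by linarith [(m.cast_nonneg : (0 : ℝ) ≤ m)]))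
      linarith
    · rcases le_total (f x) (m : ℝ) with h2 | h2
      · rw [min_eq_right h2, max_eq_right h1]
      · rw [min_eq_left h2, max_eq_right (by linarith [(m.cast_nonneg : (0 : ℝ) ≤ m)])]
        rw [abs_of_nonneg (m.cast_nonneg)]
        exact h2.trans (le_abs_self _)
  have hfm_bdd : ∀ m, ∃ C' : ℝ, ∀ x, |fm m x| ≤ C' := fun m =>
    ⟨m, fun x => by
      simp only [hfm]
      exact abs_le.2 ⟨le_max_left _ _, max_le (by linarith [(m.cast_nonneg : (0 : ℝ) ≤ m)])
        (min_le_left _ _)⟩⟩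
  have hfm_supp : ∀ m, HasCompactSupport (fm m) := fun m =>
    hfc.mono fun x hx => by
      contrapose! hx
      simp only [Function.mem_support, not_not] at hx ⊢
      simp [hfm, hx]
  have hfm_le : ∀ m, eLpNorm (fm m) p volume ≤ eLpNorm f p volume := fun m =>
    eLpNorm_mono fun x => by
      rw [Real.norm_eq_abs, Real.norm_eq_abs]
      exact hfm_abs m x
  have hfm_tend : ∀ x, Tendsto (fun m => fm m x) atTop (𝓝 (f x)) := by
    intro x
    refine tendsto_atTop_of_eventually_const (i₀ := ⌈|f x|⌉₊) fun m hm => ?_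
    have hm' : |f x| ≤ m := (Nat.le_ceil _).trans (by exact_mod_cast hm)
    simp only [hfm]
    rw [min_eq_right (le_trans (le_abs_self _) hm'), max_eq_right]
    linarith [neg_abs_le (f x)]
  -- `f ∈ L¹` (compact support)
  have hfi : Integrable f volume := by
    have h1 : MemLp f p (volume.restrict (tsupport f)) := hfp.restrict _
    haveI : IsFiniteMeasure ((volume : Measure (EuclideanSpace ℝ (Fin 3))).restrict (tsupport f)) :=
      ⟨by rw [Measure.restrict_apply_univ]; exact hfc.isCompact.measure_lt_top⟩
    have h2 : IntegrableOn f (tsupport f) volume := h1.integrable hp1.le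
    exact h2.integrable_of_forall_notMem_eq_zero fun x hx => image_eq_zero_of_notMem_tsupport hx
  -- pointwise convergence of the outputs (dominated convergence)
  have houtput : ∀ x, Tendsto (fun m => ∫ t, fm m t * k (x - t)) atTop
      (𝓝 (∫ t, f t * k (x - t))) := by
    intro x
    refine tendsto_integral_of_dominated_convergence (fun t => |f t| * Mk) ?_ ?_ ?_ ?_
    · intro m
      exact ((hfm_meas m).mul (hkc.comp (continuous_const.sub continuous_id)).measurable).aestronglyMeasurable
    · exact hfi.abs.mul_const _
    · intro m
      refine Eventually.of_forall fun t => ?_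
      rw [norm_mul, Real.norm_eq_abs, Real.norm_eq_abs]
      exact mul_le_mul (hfm_abs m t) (hMk _) (abs_nonneg _) (abs_nonneg _)
    · exact Eventually.of_forall fun t => ((hfm_tend t).mul_const _)
  -- measurability of the outputs
  have hout_meas : ∀ m, AEStronglyMeasurable (fun x => ∫ t, fm m t * k (x - t)) volume := by
    intro m
    have hF : StronglyMeasurable (uncurry fun (x t : EuclideanSpace ℝ (Fin 3)) => fm m t * k (x - t)) :=
      (((hfm_meas m).comp measurable_snd).mul
        ((hkc.measurable).comp (measurable_fst.sub measurable_snd))).stronglyMeasurable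
    exact hF.integral_prod_right'.aestronglyMeasurable
  -- Fatou
  have hFatou := Lp.eLpNorm_lim_le_liminf_eLpNorm (μ := volume) (p := p) hout_meas
    (fun x => ∫ t, f t * k (x - t)) (Eventually.of_forall houtput)
  refine hFatou.trans ?_
  refine liminf_le_of_frequently_le' (Frequently.of_forall fun m => ?_)
  exact (hC ε hε a ha (fm m) (hfm_meas m) (hfm_bdd m) (hfm_supp m)).trans
    (mul_le_mul' le_rfl (hfm_le m))

end CZ

/-! ## The quadratic near field -/

section NearField

/-- The convolution of a compactly supported `L¹ ∩ L^p` density with a bounded continuous kernel is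
a.e.-strongly measurable (Fubini). [folklore] -/
theorem aestronglyMeasurable_conv_kernel {g : EuclideanSpace ℝ (Fin 3) → ℝ} (hg : Measurable g)
    {k : EuclideanSpace ℝ (Fin 3) → ℝ} (hk : Continuous k) :
    AEStronglyMeasurable (fun x : EuclideanSpace ℝ (Fin 3) => ∫ t, g t * k (x - t)) volume := by
  have hF : StronglyMeasurable (uncurry fun (x t : EuclideanSpace ℝ (Fin 3)) => g t * k (x - t)) :=
    ((hg.comp measurable_snd).mul (hk.measurable.comp (measurable_fst.sub measurable_snd))).stronglyMeasurable
  exact hF.integral_prod_right'.aestronglyMeasurable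

-- nested operator types
set_option maxSynthPendingDepth 3 in
/-- **The quadratic near field in `L^{3/2}`, uniformly in the regularisation.** There is a
constant `C` such that for every `δ > 0` and every a.e.-strongly measurable field `w` vanishing
off a ball `B_R(x₀)` with `|w|² ∈ L^{3/2}`, the near field
`N_δ[w](c) = ∫ D²Φ_δ(c - y)(w y, w y) dy` satisfies `‖N_δ[w]‖_{3/2} ≤ C ‖|w|²‖_{3/2}`
(polarisation `D²Φ_δ(z)(bᵢ,bⱼ) = ½(∂²_{bᵢ+bⱼ} - ∂²_{bᵢ} - ∂²_{bⱼ})Φ_δ(z)` over the standard frame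
and the Calderón–Zygmund bound `exists_eLpNorm_hessConv_le_of_memLp`; Kang–Miura–Tsai §8: "By the
Calderon–Zygmund estimate, `∫ |p_loc|^q ≤ c_q ∫ |v|^{2q}`").
[cite: KangMiuraTsai2020, §8 proof of Lemma 3.4 (Calderón–Zygmund estimate for p_loc)] -/
theorem exists_eLpNorm_nearField_le :
    ∃ C : ℝ≥0, ∀ δ : ℝ, 0 < δ → ∀ (x₀ : EuclideanSpace ℝ (Fin 3)) (R : ℝ)
      (w : EuclideanSpace ℝ (Fin 3) → EuclideanSpace ℝ (Fin 3)), AEStronglyMeasurable w volume →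
      (∀ x, x ∉ ball x₀ R → w x = 0) → MemLp (fun x => ‖w x‖ ^ 2) (3 / 2) volume →
        eLpNorm (fun c => ∫ y, evalDiag (w y) (fderiv ℝ (fderiv ℝ (newtonReg δ)) (c - y))) (3 / 2) volume ≤
          C * eLpNorm (fun x => ‖w x‖ ^ 2) (3 / 2) volume := by
  have h32_1 : (1 : ℝ≥0∞) < 3 / 2 := by
    rw [ENNReal.lt_div_iff_mul_lt (Or.inl two_ne_zero) (Or.inl ENNReal.ofNat_ne_top)]; norm_num
  have h32_top : (3 / 2 : ℝ≥0∞) < ⊤ := ENNReal.div_lt_top ENNReal.ofNat_ne_top two_ne_zero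
  obtain ⟨C, hC⟩ := exists_eLpNorm_hessConv_le_of_memLp h32_1 h32_top
  refine ⟨9 * (2⁻¹ * (3 * C)), fun δ hδ x₀ R w hw hwS hw2 => ?_⟩
  set b := EuclideanSpace.basisFun (Fin 3) ℝ with hb
  set Φ : EuclideanSpace ℝ (Fin 3) → ℝ := newtonReg δ with hΦ
  have hΦ2 : ContDiff ℝ 2 Φ := contDiff_newtonReg δ (n := 2)
  -- pure second derivatives `k_a = ∂ₐ∂ₐΦ`
  set k : EuclideanSpace ℝ (Fin 3) → EuclideanSpace ℝ (Fin 3) → ℝ := fun a z =>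
    fderiv ℝ (fun s => fderiv ℝ Φ s a) z a with hk
  have hkc : ∀ a, Continuous (k a) := fun a => FluidPDE.continuous_fderiv_fderiv_apply hΦ2 a a
  have hkb : ∀ a, ∃ M : ℝ, ∀ z, |k a z| ≤ M := fun a => (continuous_and_bounded_hessKernel hδ a).2
  -- a strongly measurable representative supported in the ball
  set w' : EuclideanSpace ℝ (Fin 3) → EuclideanSpace ℝ (Fin 3) := (ball x₀ R).indicator (hw.mk w)
    with hw'
  have hw'm : StronglyMeasurable w' := hw.stronglyMeasurable_mk.indicator measurableSet_ball
  have hww' : w =ᵐ[volume] w' := by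
    filter_upwards [hw.ae_eq_mk] with x hx
    by_cases hxS : x ∈ ball x₀ R
    · rw [hw', indicator_of_mem hxS, ← hx]
    · rw [hw', indicator_of_notMem hxS, hwS x hxS]
  have hw'S : ∀ x, x ∉ ball x₀ R → w' x = 0 := fun x hx => by rw [hw', indicator_of_notMem hx]
  have hw'supp : ∀ {f : EuclideanSpace ℝ (Fin 3) → ℝ}, (∀ x, w' x = 0 → f x = 0) → HasCompactSupport f :=
    fun hf => HasCompactSupport.intro (isCompact_closedBall x₀ R) fun x hx =>
      hf x (hw'S x fun h => hx (ball_subset_closedBall h))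
  have hw'2 : MemLp (fun x => ‖w' x‖ ^ 2) (3 / 2) volume :=
    hw2.ae_eq (hww'.mono fun x hx => by simp only [hx])
  have hnorm : eLpNorm (fun x => ‖w' x‖ ^ 2) (3 / 2) volume = eLpNorm (fun x => ‖w x‖ ^ 2) (3 / 2) volume :=
    eLpNorm_congr_ae (hww'.mono fun x hx => by simp only [hx])
  -- replace `w` by `w'` in the near field
  have hNeq : (fun c => ∫ y, evalDiag (w y) (fderiv ℝ (fderiv ℝ Φ) (c - y))) =
      fun c => ∫ y, evalDiag (w' y) (fderiv ℝ (fderiv ℝ Φ) (c - y)) := by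
    funext c
    exact integral_congr_ae (hww'.mono fun y hy => by
      show evalDiag (w y) _ = evalDiag (w' y) _
      rw [hy])
  rw [hNeq, ← hnorm]
  -- the coefficient densities `gᵢⱼ = w'ᵢ w'ⱼ`
  set g : Fin 3 → Fin 3 → EuclideanSpace ℝ (Fin 3) → ℝ := fun i j y => ⟪w' y, b i⟫ * ⟪w' y, b j⟫ with hg
  have hgm : ∀ i j, Measurable (g i j) := fun i j =>
    (hw'm.measurable.inner measurable_const).mul (hw'm.measurable.inner measurable_const)
  have hg_le : ∀ i j y, ‖g i j y‖ ≤ ‖w' y‖ ^ 2 := by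
    intro i j y
    rw [hg]
    dsimp only
    rw [norm_mul, Real.norm_eq_abs, Real.norm_eq_abs]
    have h1 : |⟪w' y, b i⟫| ≤ ‖w' y‖ := by
      have := abs_real_inner_le_norm (w' y) (b i)
      rwa [b.norm_eq_one, mul_one] at this
    have h2 : |⟪w' y, b j⟫| ≤ ‖w' y‖ := by
      have := abs_real_inner_le_norm (w' y) (b j)
      rwa [b.norm_eq_one, mul_one] at this
    calc |⟪w' y, b i⟫| * |⟪w' y, b j⟫| ≤ ‖w' y‖ * ‖w' y‖ :=
          mul_le_mul h1 h2 (abs_nonneg _) (norm_nonneg _)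
      _ = ‖w' y‖ ^ 2 := by ring
  have hg_mem : ∀ i j, MemLp (g i j) (3 / 2) volume := fun i j =>
    hw'2.of_le (hgm i j).aestronglyMeasurable (Eventually.of_forall fun y => by
      rw [Real.norm_of_nonneg (sq_nonneg _)]; exact hg_le i j y)
  have hg_supp : ∀ i j, HasCompactSupport (g i j) := fun i j =>
    hw'supp fun x hx => by simp [hg, hx]
  have hg_norm : ∀ i j, eLpNorm (g i j) (3 / 2) volume ≤ eLpNorm (fun x => ‖w' x‖ ^ 2) (3 / 2) volume :=
    fun i j => eLpNorm_mono fun y => by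
      rw [Real.norm_of_nonneg (sq_nonneg ‖w' y‖)]; exact hg_le i j y
  have hgi : ∀ i j, Integrable (g i j) volume := by
    intro i j
    have h1 : MemLp (g i j) (3 / 2) (volume.restrict (closedBall x₀ R)) := (hg_mem i j).restrict _
    haveI : IsFiniteMeasure ((volume : Measure (EuclideanSpace ℝ (Fin 3))).restrict (closedBall x₀ R)) :=
      ⟨by rw [Measure.restrict_apply_univ]; exact measure_closedBall_lt_top⟩
    have h2 : IntegrableOn (g i j) (closedBall x₀ R) volume := h1.integrable h32_1.le
    exact h2.integrable_of_forall_notMem_eq_zero fun x hx => by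
      have : w' x = 0 := hw'S x fun h => hx (ball_subset_closedBall h)
      simp [hg, this]
  -- the convolutions `T_a gᵢⱼ`
  set T : EuclideanSpace ℝ (Fin 3) → Fin 3 → Fin 3 → EuclideanSpace ℝ (Fin 3) → ℝ :=
    fun a i j c => ∫ y, g i j y * k a (c - y) with hT
  have hTm : ∀ a i j, AEStronglyMeasurable (T a i j) volume := fun a i j =>
    aestronglyMeasurable_conv_kernel (hgm i j) (hkc a)
  have hTi : ∀ a i j c, Integrable (fun y => g i j y * k a (c - y)) volume := by
    intro a i j c
    obtain ⟨M, hM⟩ := hkb a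
    refine (hgi i j).mul_bdd (c := M) ((hkc a).comp (continuous_const.sub continuous_id)).aestronglyMeasurable
      (ae_of_all _ fun y => ?_)
    rw [Real.norm_eq_abs]; exact hM _
  have hTbound : ∀ a, ‖a‖ ≤ 2 → ∀ i j, eLpNorm (T a i j) (3 / 2) volume ≤
      C * eLpNorm (fun x => ‖w' x‖ ^ 2) (3 / 2) volume := fun a ha i j =>
    (hC δ hδ a ha (g i j) (hgm i j) (hg_supp i j) (hg_mem i j)).trans (mul_le_mul' le_rfl (hg_norm i j))
  -- polarisation: the near field as a sum of convolutions
  set F : Fin 3 → Fin 3 → EuclideanSpace ℝ (Fin 3) → ℝ := fun i j =>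
    (2⁻¹ : ℝ) • (T (b j + b i) i j - T (b j) i j - T (b i) i j) with hF
  have hkey : (fun c => ∫ y, evalDiag (w' y) (fderiv ℝ (fderiv ℝ Φ) (c - y))) = ∑ i, ∑ j, F i j := by
    funext c
    rw [Finset.sum_apply]
    simp_rw [Finset.sum_apply]
    have hd : ∀ z, DifferentiableAt ℝ (fderiv ℝ Φ) z := fun z =>
      ((hΦ2.fderiv_right (m := 1) le_rfl).differentiable one_ne_zero) z
    have hpt : ∀ y, evalDiag (w' y) (fderiv ℝ (fderiv ℝ Φ) (c - y)) =
        ∑ i, ∑ j, g i j y * (2⁻¹ * (k (b j + b i) (c - y) - k (b j) (c - y) - k (b i) (c - y))) := by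
      intro y
      rw [evalDiag_apply, clm_apply_apply_eq_sum_basisFun]
      refine Finset.sum_congr rfl fun i _ => Finset.sum_congr rfl fun j _ => ?_
      rw [hg, hk]
      dsimp only
      rw [← FluidPDE.fderiv_apply_const_apply (hd (c - y)) (b j) (b i),
        fderiv_fderiv_apply_polarisation hΦ2 (c - y) (b j) (b i)]
    simp_rw [hpt]
    have hterm : ∀ i j, Integrable (fun y => g i j y *
        (2⁻¹ * (k (b j + b i) (c - y) - k (b j) (c - y) - k (b i) (c - y)))) volume := by
      intro i j
      have h := (((hTi (b j + b i) i j c).sub (hTi (b j) i j c)).sub (hTi (b i) i j c)).const_mul (2⁻¹ : ℝ)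
      refine h.congr (Eventually.of_forall fun y => ?_)
      simp only [Pi.sub_apply]
      ring
    rw [integral_finsetSum _ (fun i _ => integrable_finsetSum _ fun j _ => hterm i j)]
    refine Finset.sum_congr rfl fun i _ => ?_
    rw [integral_finsetSum _ (fun j _ => hterm i j)]
    refine Finset.sum_congr rfl fun j _ => ?_
    rw [hF]
    simp only [Pi.smul_apply, Pi.sub_apply, smul_eq_mul, hT]
    have e1 : ∀ y, g i j y * (2⁻¹ * (k (b j + b i) (c - y) - k (b j) (c - y) - k (b i) (c - y))) =
        2⁻¹ * (g i j y * k (b j + b i) (c - y) - g i j y * k (b j) (c - y) -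
          g i j y * k (b i) (c - y)) := fun y => by ring
    simp_rw [e1]
    rw [integral_const_mul,
      integral_sub (f := fun y => g i j y * k (b j + b i) (c - y) - g i j y * k (b j) (c - y))
        (g := fun y => g i j y * k (b i) (c - y)) ((hTi (b j + b i) i j c).sub (hTi (b j) i j c))
        (hTi (b i) i j c),
      integral_sub (hTi (b j + b i) i j c) (hTi (b j) i j c)]
  rw [show (fderiv ℝ (fderiv ℝ Φ)) = fderiv ℝ (fderiv ℝ (newtonReg δ)) from rfl] at hkey
  rw [hkey]
  -- norms of the summands
  have hFm : ∀ i j, AEStronglyMeasurable (F i j) volume := fun i j =>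
    (((hTm _ i j).sub (hTm _ i j)).sub (hTm _ i j)).const_smul _
  have hb1 : ∀ i, ‖b i‖ ≤ 2 := fun i => by rw [b.norm_eq_one]; norm_num
  have hb2 : ∀ i j, ‖b j + b i‖ ≤ 2 := fun i j =>
    (norm_add_le _ _).trans (by rw [b.norm_eq_one, b.norm_eq_one]; norm_num)
  have hFbound : ∀ i j, eLpNorm (F i j) (3 / 2) volume ≤
      (2⁻¹ * (3 * C) : ℝ≥0) * eLpNorm (fun x => ‖w' x‖ ^ 2) (3 / 2) volume := by
    intro i j
    rw [hF, eLpNorm_const_smul]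
    have e2 : ‖(2⁻¹ : ℝ)‖ₑ = ((2⁻¹ : ℝ≥0) : ℝ≥0∞) := by
      rw [Real.enorm_eq_ofReal (by norm_num), ENNReal.ofReal_inv_of_pos (by norm_num), ENNReal.ofReal_ofNat]
      norm_num
    rw [e2, ENNReal.coe_mul, mul_assoc]
    gcongr
    calc eLpNorm (T (b j + b i) i j - T (b j) i j - T (b i) i j) (3 / 2) volume
        ≤ eLpNorm (T (b j + b i) i j - T (b j) i j) (3 / 2) volume + eLpNorm (T (b i) i j) (3 / 2) volume :=
          eLpNorm_sub_le ((hTm _ i j).sub (hTm _ i j)) (hTm _ i j) h32_1.le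
      _ ≤ (eLpNorm (T (b j + b i) i j) (3 / 2) volume + eLpNorm (T (b j) i j) (3 / 2) volume) +
            eLpNorm (T (b i) i j) (3 / 2) volume := by
          gcongr
          exact eLpNorm_sub_le (hTm _ i j) (hTm _ i j) h32_1.le
      _ ≤ (C * eLpNorm (fun x => ‖w' x‖ ^ 2) (3 / 2) volume + C * eLpNorm (fun x => ‖w' x‖ ^ 2) (3 / 2) volume) +
            C * eLpNorm (fun x => ‖w' x‖ ^ 2) (3 / 2) volume :=
          add_le_add (add_le_add (hTbound _ (hb2 i j) i j) (hTbound _ (hb1 j) i j)) (hTbound _ (hb1 i) i j)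
      _ = ((3 * C : ℝ≥0) : ℝ≥0∞) * eLpNorm (fun x => ‖w' x‖ ^ 2) (3 / 2) volume := by
          push_cast; ring
  calc eLpNorm (∑ i, ∑ j, F i j) (3 / 2) volume ≤ ∑ i, eLpNorm (∑ j, F i j) (3 / 2) volume :=
        eLpNorm_sum_le (fun i _ => Finset.aestronglyMeasurable_sum _ fun j _ => hFm i j) h32_1.le
    _ ≤ ∑ i, ∑ j, eLpNorm (F i j) (3 / 2) volume :=
        Finset.sum_le_sum fun i _ => eLpNorm_sum_le (fun j _ => hFm i j) h32_1.le
    _ ≤ ∑ _i : Fin 3, ∑ _j : Fin 3, ((2⁻¹ * (3 * C) : ℝ≥0) : ℝ≥0∞) * eLpNorm (fun x => ‖w' x‖ ^ 2) (3 / 2) volume :=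
        Finset.sum_le_sum fun i _ => Finset.sum_le_sum fun j _ => hFbound i j
    _ = ((9 * (2⁻¹ * (3 * C)) : ℝ≥0) : ℝ≥0∞) * eLpNorm (fun x => ‖w' x‖ ^ 2) (3 / 2) volume := by
        simp only [Finset.sum_const, Finset.card_univ, Fintype.card_fin, nsmul_eq_mul]
        push_cast
        ring

end NearField

/-! ## The mollifiers `λ_δ = ΔΦ_δ` -/

section Mollifier

variable {δ : ℝ}

/-- `λ_δ(z) = δ⁻³ λ₁(δ⁻¹ z)` with `λ₁ = newtonFarLaplacian (1/2) 1`. [folklore] -/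
theorem laplacian_newtonReg_eq_scale (hδ : 0 < δ) (z : EuclideanSpace ℝ (Fin 3)) :
    Δ (newtonReg δ) z = δ⁻¹ ^ 3 * newtonFarLaplacian (1 / 2) 1 (δ⁻¹ • z) := by
  rw [laplacian_newtonReg hδ]
  have h := newtonFarLaplacian_scale hδ (1 / 2) 1 z
  rwa [mul_one, show δ * (1 / 2) = δ / 2 by ring] at h

/-- **Sup bound** `|λ_δ| ≤ M δ⁻³` with `M` a bound for `|λ₁|`. [folklore] -/
theorem exists_abs_laplacian_newtonReg_le :
    ∃ M : ℝ, 0 ≤ M ∧ ∀ δ : ℝ, 0 < δ → ∀ z : EuclideanSpace ℝ (Fin 3),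
      |Δ (newtonReg δ) z| ≤ M * δ⁻¹ ^ 3 := by
  obtain ⟨M₀, hM₀⟩ := (continuous_newtonFarLaplacian (r₀ := 1 / 2) (r₁ := 1) (by norm_num)
    (by norm_num)).bounded_above_of_compact_support
    (hasCompactSupport_newtonFarLaplacian (r₀ := 1 / 2) (r₁ := 1) (by norm_num) (by norm_num))
  set M : ℝ := max M₀ 0 with hMdef
  have hM0 : 0 ≤ M := le_max_right _ _
  have hM : ∀ z : EuclideanSpace ℝ (Fin 3), |newtonFarLaplacian (1 / 2) 1 z| ≤ M := fun z =>
    (Real.norm_eq_abs _ ▸ hM₀ z).trans (le_max_left _ _)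
  refine ⟨M, hM0, fun δ hδ z => ?_⟩
  rw [laplacian_newtonReg_eq_scale hδ, abs_mul, abs_of_pos (by positivity), mul_comm]
  exact mul_le_mul_of_nonneg_right (hM _) (by positivity)

/-- `∫ λ_δ = 1`. [folklore] -/
theorem integral_laplacian_newtonReg (hδ : 0 < δ) : ∫ z, Δ (newtonReg δ) z = 1 := by
  rw [laplacian_newtonReg hδ]
  exact integral_newtonFarLaplacian (half_pos_lt hδ).1 (half_pos_lt hδ).2

/-- `λ_δ` is continuous, compactly supported, integrable, vanishing off `B̄(0, δ)`. [folklore] -/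
theorem laplacian_newtonReg_props (hδ : 0 < δ) :
    Continuous (Δ (newtonReg δ)) ∧ HasCompactSupport (Δ (newtonReg δ)) ∧
      Integrable (Δ (newtonReg δ)) volume ∧
      ∀ z : EuclideanSpace ℝ (Fin 3), δ < ‖z‖ → Δ (newtonReg δ) z = 0 := by
  refine ⟨continuous_laplacian_newtonReg hδ, ?_, integrable_laplacian_newtonReg hδ,
    fun z hz => laplacian_newtonReg_eq_zero hδ hz⟩
  rw [laplacian_newtonReg hδ]
  exact hasCompactSupport_newtonFarLaplacian (half_pos_lt hδ).1.le (half_pos_lt hδ).2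

/-- **Lebesgue points: the mollifications `λ_δ ⋆ p` converge to `p` a.e.** For a locally
integrable `p` on `ℝ³` and `δₙ = 1/(n+1)`, `(λ_{δₙ} ⋆ p)(c) → p(c)` for a.e. `c`
(`|λ_δ ⋆ p(c) - p(c)| ≤ M |B̄₁| ⨍_{B̄(c,δ)} |p - p(c)|` and the Lebesgue differentiation theorem
for doubling measures). [folklore] -/
theorem ae_tendsto_laplacian_newtonReg_convolution {p : EuclideanSpace ℝ (Fin 3) → ℝ}
    (hp : LocallyIntegrable p volume) :
    ∀ᵐ c : EuclideanSpace ℝ (Fin 3), Tendsto (fun n : ℕ =>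
      (Δ (newtonReg ((n : ℝ) + 1)⁻¹) ⋆[ContinuousLinearMap.lsmul ℝ ℝ, volume] p) c) atTop (𝓝 (p c)) := by
  obtain ⟨M, hM0, hM⟩ := exists_abs_laplacian_newtonReg_le
  set dn : ℕ → ℝ := fun n => ((n : ℝ) + 1)⁻¹ with hdn
  have hdn0 : ∀ n, 0 < dn n := fun n => by positivity
  have hdlim : Tendsto dn atTop (𝓝[>] 0) := by
    refine tendsto_nhdsWithin_iff.2 ⟨?_, Eventually.of_forall fun n => hdn0 n⟩
    exact tendsto_one_div_add_atTop_nhds_zero_nat.congr fun n => by simp [hdn]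
  set V : ℝ := (volume (closedBall (0 : EuclideanSpace ℝ (Fin 3)) 1)).toReal with hV
  have hLeb := IsUnifLocDoublingMeasure.ae_tendsto_average_norm_sub (μ := volume) hp 1
  filter_upwards [hLeb] with c hc
  have hav := hc (fun _ : ℕ => c) dn hdlim (Eventually.of_forall fun n => by
    rw [one_mul]; exact mem_closedBall_self (hdn0 n).le)
  -- the bound `|λₙ ⋆ p (c) - p c| ≤ M V ⨍ |p - p c|`
  have hbound : ∀ n, ‖(Δ (newtonReg (dn n)) ⋆[ContinuousLinearMap.lsmul ℝ ℝ, volume] p) c - p c‖ ≤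
      M * V * ⨍ y in closedBall c (dn n), ‖p y - p c‖ := by
    intro n
    obtain ⟨hlc, hls, hli, hl0⟩ := laplacian_newtonReg_props (hdn0 n)
    set lam : EuclideanSpace ℝ (Fin 3) → ℝ := Δ (newtonReg (dn n)) with hlam
    -- integrability of `s ↦ λ(s) p(c - s)`
    have hex : Integrable (fun s => lam s * p (c - s)) volume := by
      have h := hls.convolutionExists_left (ContinuousLinearMap.lsmul ℝ ℝ) hlc hp c
      simpa [ConvolutionExistsAt] using h
    have hrepr : (lam ⋆[ContinuousLinearMap.lsmul ℝ ℝ, volume] p) c - p c =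
        ∫ s, lam s * (p (c - s) - p c) := by
      rw [convolution_lsmul_apply]
      have h1 : p c = ∫ s, lam s * p c := by
        rw [integral_mul_const, hlam, integral_laplacian_newtonReg (hdn0 n), one_mul]
      conv_lhs => rw [h1]
      rw [← integral_sub hex (hli.mul_const _)]
      refine integral_congr_ae (Eventually.of_forall fun s => ?_)
      ring
    rw [hrepr]
    -- pointwise bound by `M δ⁻³ 1_{B̄(0,δ)}(s) |p(c-s) - p c|`
    set f : EuclideanSpace ℝ (Fin 3) → ℝ := fun y => (closedBall c (dn n)).indicator (fun y => ‖p y - p c‖) y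
      with hf
    have hfint : Integrable f volume := by
      have h1 : IntegrableOn (fun y => ‖p y - p c‖) (closedBall c (dn n)) volume :=
        ((hp.integrableOn_isCompact (isCompact_closedBall _ _)).sub
          (integrableOn_const_iff (by simp) |>.2 (Or.inr measure_closedBall_lt_top))).norm
      exact h1.integrable_indicator measurableSet_closedBall
    have hpt : ∀ s, ‖lam s * (p (c - s) - p c)‖ ≤ M * (dn n)⁻¹ ^ 3 * f (c - s) := by
      intro s
      rw [norm_mul, Real.norm_eq_abs]
      by_cases hs : dn n < ‖s‖
      · rw [hl0 s hs, abs_zero, zero_mul]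
        exact mul_nonneg (by positivity) (indicator_nonneg (fun _ _ => norm_nonneg _) _)
      · push Not at hs
        have hmem : c - s ∈ closedBall c (dn n) := by
          rw [mem_closedBall, dist_eq_norm, sub_sub_cancel_left, norm_neg]
          exact hs
        rw [hf]
        dsimp only
        rw [indicator_of_mem hmem]
        exact mul_le_mul_of_nonneg_right (hM _ (hdn0 n) s) (norm_nonneg _)
    have hI : ∫ s, f (c - s) = V * (dn n) ^ 3 * ⨍ y in closedBall c (dn n), ‖p y - p c‖ := by
      rw [integral_sub_left_eq_self f volume c, hf, integral_indicator measurableSet_closedBall,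
        setAverage_eq, smul_eq_mul, measureReal_def,
        Measure.addHaar_closedBall' volume c (hdn0 n).le, finrank_euclideanSpace_fin,
        ENNReal.toReal_mul, ENNReal.toReal_ofReal (by positivity), hV]
      have hV0 : (volume (closedBall (0 : EuclideanSpace ℝ (Fin 3)) 1)).toReal ≠ 0 :=
        ENNReal.toReal_ne_zero.2 ⟨(measure_closedBall_pos volume _ one_pos).ne', measure_closedBall_lt_top.ne⟩
      have hd0 : (dn n) ^ 3 ≠ 0 := by positivity
      have hd0' : dn n ≠ 0 := (hdn0 n).ne'
      field_simp
    calc ‖∫ s, lam s * (p (c - s) - p c)‖ ≤ ∫ s, M * (dn n)⁻¹ ^ 3 * f (c - s) :=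
          norm_integral_le_of_norm_le ((hfint.comp_sub_left c).const_mul _) (Eventually.of_forall hpt)
      _ = M * (dn n)⁻¹ ^ 3 * (V * (dn n) ^ 3 * ⨍ y in closedBall c (dn n), ‖p y - p c‖) := by
          rw [integral_const_mul, hI]
      _ = M * V * ⨍ y in closedBall c (dn n), ‖p y - p c‖ := by
          have hd0 : (dn n) ≠ 0 := (hdn0 n).ne'
          field_simp
  have hlim : Tendsto (fun n => M * V * ⨍ y in closedBall c (dn n), ‖p y - p c‖) atTop (𝓝 0) := by
    have := hav.const_mul (M * V)
    rwa [mul_zero] at this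
  exact tendsto_iff_norm_sub_tendsto_zero.2 (squeeze_zero (fun n => norm_nonneg _) hbound hlim)

/-- **`L¹` bound for the mollification on balls**: for `δ ≤ 1`,
`∫_{B_r(x₀)} |λ_δ ⋆ p| ≤ (∫|λ_δ|) ∫_{B_{r+1}(x₀)} |p|` (Tonelli; `λ_δ` lives on `B̄(0, δ)`).
[folklore] -/
theorem lintegral_ball_laplacian_newtonReg_convolution_le (hδ : 0 < δ) (hδ1 : δ ≤ 1)
    {p : EuclideanSpace ℝ (Fin 3) → ℝ} (hp : LocallyIntegrable p volume)
    (x₀ : EuclideanSpace ℝ (Fin 3)) (r : ℝ) :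
    ∫⁻ c in ball x₀ r, ‖(Δ (newtonReg δ) ⋆[ContinuousLinearMap.lsmul ℝ ℝ, volume] p) c‖ₑ ≤
      (∫⁻ s, ‖Δ (newtonReg δ) s‖ₑ) * ∫⁻ y in ball x₀ (r + 1), ‖p y‖ₑ := by
  obtain ⟨hlc, hls, hli, hl0⟩ := laplacian_newtonReg_props hδ
  set lam : EuclideanSpace ℝ (Fin 3) → ℝ := Δ (newtonReg δ) with hlam
  have hpm : AEStronglyMeasurable p volume := hp.aestronglyMeasurable
  -- pointwise: `‖λ ⋆ p (c)‖ₑ ≤ ∫⁻ ‖λ s‖ₑ ‖p(c-s)‖ₑ`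
  have hpt : ∀ c, ‖(lam ⋆[ContinuousLinearMap.lsmul ℝ ℝ, volume] p) c‖ₑ ≤
      ∫⁻ s, ‖lam s‖ₑ * ‖p (c - s)‖ₑ := fun c => by
    rw [convolution_lsmul_apply]
    refine (enorm_integral_le_lintegral_enorm _).trans (lintegral_mono fun s => ?_)
    rw [enorm_mul]
  -- Tonelli
  have hpq : AEStronglyMeasurable (fun q : EuclideanSpace ℝ (Fin 3) × EuclideanSpace ℝ (Fin 3) =>
      p (q.1 - q.2)) ((volume : Measure (EuclideanSpace ℝ (Fin 3))).prod volume) :=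
    hpm.comp_quasiMeasurePreserving (quasiMeasurePreserving_sub (volume : Measure (EuclideanSpace ℝ (Fin 3))) volume)
  have hF : AEMeasurable (fun q : EuclideanSpace ℝ (Fin 3) × EuclideanSpace ℝ (Fin 3) =>
      ‖lam q.2‖ₑ * ‖p (q.1 - q.2)‖ₑ) ((volume.restrict (ball x₀ r)).prod volume) :=
    ((hlc.measurable.comp measurable_snd).enorm.aemeasurable).mul
      ((hpq.mono_measure (Measure.prod_mono Measure.restrict_le_self le_rfl)).enorm)
  -- translation: `∫_{B_r(x₀)} |p(c - s)| dc ≤ ∫_{B_{r+1}(x₀)} |p|` for `|s| ≤ 1`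
  have htrans : ∀ s : EuclideanSpace ℝ (Fin 3), ‖s‖ ≤ 1 →
      ∫⁻ c in ball x₀ r, ‖p (c - s)‖ₑ ≤ ∫⁻ y in ball x₀ (r + 1), ‖p y‖ₑ := by
    intro s hs
    rw [← lintegral_indicator measurableSet_ball, ← lintegral_indicator measurableSet_ball]
    have h1 : ∫⁻ c, (ball x₀ r).indicator (fun c => ‖p (c - s)‖ₑ) c =
        ∫⁻ y, (ball x₀ r).indicator (fun c => ‖p (c - s)‖ₑ) (y + s) :=
      (lintegral_add_right_eq_self _ s).symm
    rw [h1]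
    refine lintegral_mono fun y => ?_
    by_cases hy : y + s ∈ ball x₀ r
    · have hy' : y ∈ ball x₀ (r + 1) := by
        rw [mem_ball, dist_eq_norm] at hy ⊢
        calc ‖y - x₀‖ = ‖(y + s - x₀) - s‖ := by abel_nf
          _ ≤ ‖y + s - x₀‖ + ‖s‖ := norm_sub_le _ _
          _ < r + 1 := by linarith
      rw [indicator_of_mem hy, indicator_of_mem hy', add_sub_cancel_right]
    · rw [indicator_of_notMem hy]
      exact zero_le
  calc ∫⁻ c in ball x₀ r, ‖(lam ⋆[ContinuousLinearMap.lsmul ℝ ℝ, volume] p) c‖ₑ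
      ≤ ∫⁻ c in ball x₀ r, ∫⁻ s, ‖lam s‖ₑ * ‖p (c - s)‖ₑ := lintegral_mono fun c => hpt c
    _ = ∫⁻ s, ∫⁻ c in ball x₀ r, ‖lam s‖ₑ * ‖p (c - s)‖ₑ := lintegral_lintegral_swap hF
    _ = ∫⁻ s, ‖lam s‖ₑ * ∫⁻ c in ball x₀ r, ‖p (c - s)‖ₑ := by
        refine lintegral_congr fun s => ?_
        rw [lintegral_const_mul' _ _ enorm_ne_top]
    _ ≤ ∫⁻ s, ‖lam s‖ₑ * ∫⁻ y in ball x₀ (r + 1), ‖p y‖ₑ := by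
        refine lintegral_mono fun s => ?_
        by_cases hs : δ < ‖s‖
        · rw [hl0 s hs, enorm_zero, zero_mul, zero_mul]
        · push Not at hs
          exact mul_le_mul' le_rfl (htrans s (hs.trans hδ1))
    _ = (∫⁻ s, ‖lam s‖ₑ) * ∫⁻ y in ball x₀ (r + 1), ‖p y‖ₑ :=
        lintegral_mul_const _ hlc.measurable.enorm

end Mollifier

end Literature.Analysis.FluidPDE
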